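import Literature.AlgebraicGeometry.Resolution.RsopMonomialIdeals
import HarnessLib

/-!
# [OURS · L1 W4.2] σ-LAYER helper — `Corridor3SigmaRsopRechoice`: RE-CHOOSING an rsop-generated centre's frame THROUGH a given order-one element
# (the «≈30-line `IsRsopPart` re-choice lemma NOT yet typed» named by res-D-pv-060 g8 at its gen-8 CLOSING 2026-08-27T19:50:48Z as the last input of
# (G10b)'s (L3′) S-safety: with it, `…Corridor3SigmaTameSurfaceThreefoldSide` `Helpers.map_unit_mul_pow_of_mem` / `map_unit_mul_pow_self` (p563600) apply to
# EVERY regular centre `D ⊂ Σ = V(w)`, because the centre's frame can be taken to CONTAIN `w`)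
# (crux chain w42 `SigmaMaxModifications` stmt-ResolutionOfSingularities-18506 / conjunct `SigmaMaxModificationsCorridor3` stmt-ResolutionOfSingularities-19249;
# seat res-L1-type-o2 g9 = «res-type-067/068 SUCCESSOR», (G10) reading owner; `--supports stmt-ResolutionOfSingularities-19249 --as helper`, counted 0)

HONEST FRAMING. OURS, elementary commutative algebra over the tree's `IsRsopPart` (Matsumura 14.2 bookkeeping); sorry-free, no `def`, no named fact, no axiom.
NOTHING here is a statement of H. Hironaka's manuscript [Hironaka2017] nor of Cossart–Jannsen–Saito / Cossart–Piltant. AI-typed; AI review weaker than expert review.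

## Contents (namespace `…Theorems.SigmaMaxModificationsCorridor3.Helpers`)

* `span_range_update_eq_of_isUnit` — for any family `v : Fin k → R` and coefficients `c` with `c i₀` a UNIT: replacing `v i₀` by `w := Σ c_i v_i` does not
  change the ideal `(v)`.
* `exists_isUnit_coeff_of_not_mem_sq` — in a local ring, if `w = Σ c_i v_i` with all `v_i ∈ 𝔪` and `w ∉ 𝔪²`, some coefficient `c i₀` is a unit.
* `isRsopPart_of_span_range_eq` — `IsRsopPart` depends on the family only through the ideal it spans and its length.
* **`exists_isRsopPart_update_of_mem_of_not_mem_sq`** — THE RE-CHOICE: `v` part of a regular system of parameters, `w ∈ (v)`, `w ∉ 𝔪²` ⇒ for some slot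
  `i₀`, `Function.update v i₀ w` is again part of a regular system of parameters and spans the same ideal (the centre `V((v))` is unchanged, its frame now
  passes THROUGH `w`).
-/

set_option linter.dupNamespace false -- mandated namespace of this single-conjunct summit

namespace Summit.ResolutionOfSingularities.ResolutionOfSingularities.Theorems.SigmaMaxModificationsCorridor3.Helpers

open IsLocalRing Literature.AlgebraicGeometry.Resolution

universe u

variable {R : Type u} [CommRing R] {k : ℕ}

/-- **Replacing one generator by a combination with a unit coefficient in its own slot keeps the span**: `c i₀` a unit ⇒
`(update v i₀ (Σ c_i v_i)) = (v)` as ideals. [folklore] -/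
theorem span_range_update_eq_of_isUnit (v : Fin k → R) (c : Fin k → R) (i₀ : Fin k) (hc : IsUnit (c i₀)) :
    Ideal.span (Set.range (Function.update v i₀ (∑ i, c i * v i))) = Ideal.span (Set.range v) := by
  classical
  set w : R := ∑ i, c i * v i with hw
  apply le_antisymm
  · -- every new generator lies in `(v)`
    refine Ideal.span_le.mpr ?_
    rintro _ ⟨j, rfl⟩
    by_cases hj : j = i₀
    · subst hj
      rw [Function.update_self]
      exact Ideal.sum_mem _ fun i _ => Ideal.mul_mem_left _ _ (Ideal.subset_span ⟨i, rfl⟩)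
    · rw [Function.update_of_ne hj]
      exact Ideal.subset_span ⟨j, rfl⟩
  · -- every old generator lies in the new span; only `v i₀` needs work
    refine Ideal.span_le.mpr ?_
    rintro _ ⟨j, rfl⟩
    by_cases hj : j = i₀
    · subst hj
      have hmemw : w ∈ Ideal.span (Set.range (Function.update v j w)) :=
        Ideal.subset_span ⟨j, Function.update_self j w v⟩
      have hrest : ∑ i ∈ Finset.univ.erase j, c i * v i ∈ Ideal.span (Set.range (Function.update v j w)) := by
        refine Ideal.sum_mem _ fun i hi => Ideal.mul_mem_left _ _ (Ideal.subset_span ⟨i, ?_⟩)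
        rw [Function.update_of_ne (Finset.ne_of_mem_erase hi)]
      have hsplit : c j * v j = w - ∑ i ∈ Finset.univ.erase j, c i * v i := by
        rw [hw, ← Finset.add_sum_erase Finset.univ (fun i => c i * v i) (Finset.mem_univ j)]
        ring
      have hcv : c j * v j ∈ Ideal.span (Set.range (Function.update v j w)) := by
        rw [hsplit]
        exact Ideal.sub_mem _ hmemw hrest
      obtain ⟨u, hu⟩ := hc
      have : v j = ↑u⁻¹ * (c j * v j) := by rw [← hu, ← mul_assoc, Units.inv_mul, one_mul]
      rw [this]
      exact Ideal.mul_mem_left _ _ hcv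
    · exact Ideal.subset_span ⟨j, (Function.update_of_ne hj w v)⟩

variable [IsLocalRing R]

/-- **In a local ring, an element of `(v)` outside `𝔪²` (all `v_i ∈ 𝔪`) has a UNIT coefficient in some slot.** [folklore] -/
theorem exists_isUnit_coeff_of_not_mem_sq {v : Fin k → R} (hv : ∀ i, v i ∈ maximalIdeal R) {c : Fin k → R} {w : R}
    (hcw : ∑ i, c i * v i = w) (hw2 : w ∉ maximalIdeal R ^ 2) : ∃ i₀, IsUnit (c i₀) := by
  by_contra hnone
  push Not at hnone
  apply hw2
  rw [← hcw, pow_two]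
  exact Ideal.sum_mem _ fun i _ => Ideal.mul_mem_mul ((mem_maximalIdeal _).mpr (hnone i)) (hv i)

/-- **`IsRsopPart` sees the family only through its span (and length)**: a family of the same length spanning the same ideal is again part of a regular
system of parameters. [cite: Matsumura1987, Thm. 14.2] -/
theorem isRsopPart_of_span_range_eq {v v' : Fin k → R} (hv : IsRsopPart v) (h : Ideal.span (Set.range v') = Ideal.span (Set.range v)) :
    IsRsopPart v' := by
  obtain ⟨hreg, e, y, hdim, hspan⟩ := hv
  refine ⟨hreg, e, y, hdim, ?_⟩
  rw [Ideal.span_union, h, ← Ideal.span_union, hspan]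

/-- **THE RE-CHOICE LEMMA.** If `v` is part of a regular system of parameters (the frame of a regular centre `V((v))`) and `w ∈ (v)` with `w ∉ 𝔪²`
(an order-one element vanishing on the centre — e.g. the surface equation `w` when the centre lies inside `Σ = V(w)`), then for some slot `i₀` the
family `update v i₀ w` is again part of a regular system of parameters AND spans the same ideal: the centre's frame can be chosen THROUGH `w`.
[cite: Matsumura1987, Thm. 14.2] -/
theorem exists_isRsopPart_update_of_mem_of_not_mem_sq {v : Fin k → R} (hv : IsRsopPart v) {w : R} (hw : w ∈ Ideal.span (Set.range v))
    (hw2 : w ∉ maximalIdeal R ^ 2) :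
    ∃ i₀ : Fin k, IsRsopPart (Function.update v i₀ w) ∧ Ideal.span (Set.range (Function.update v i₀ w)) = Ideal.span (Set.range v) := by
  classical
  obtain ⟨c, hcw⟩ := Ideal.mem_span_range_iff_exists_fun.mp hw
  obtain ⟨i₀, hi₀⟩ := exists_isUnit_coeff_of_not_mem_sq hv.mem_maximalIdeal hcw hw2
  have hspan : Ideal.span (Set.range (Function.update v i₀ w)) = Ideal.span (Set.range v) := by
    rw [← hcw]
    exact span_range_update_eq_of_isUnit v c i₀ hi₀
  exact ⟨i₀, isRsopPart_of_span_range_eq hv hspan, hspan⟩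

end Summit.ResolutionOfSingularities.ResolutionOfSingularities.Theorems.SigmaMaxModificationsCorridor3.Helpers
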